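import Literature.Probability.Percolation.MarkedLoopNecessitySeven
import Literature.Probability.Percolation.MarkedLoopPicturesSeven
import HarnessLib

/-!
# Seven disorders: TRIPOD LAW ⟺ DISCRETE HOLOMORPHICITY ON EVERY SEVEN-MARKED DOMAIN («TRIPOD-NECESSITY-SEVEN», statement)

Topic `Literature/Probability/Percolation`; generic-`k` layer of the three-disorder lineage (Khristoforov–Smirnov 2021) at `k = 7`: the assembly
of `MarkedLoopNecessitySeven.lean` (census half: holomorphic on the seven rotations of the marked rhombus ⇒ all 21 class defects vanish) with
`MarkedLoopPicturesSeven.lean` (classification: the tripod law at seven marks IS the 21 relations) and HOLO-K (`holomorphicW_of_tripodLaw'`: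
tripod law ⇒ holomorphic on every domain, Khristoforov–Smirnov's Lemma 4 for class weights). The k = 7 sequel of the tree's
`tripodLaw_iff_forall_holomorphicW_five` / `tripodLaw_iff_holomorphicW_rotates` / `holomorphic_const_iff_five`:

* ★★★★ `tripodLaw_iff_forall_holomorphicW_seven` — **for seven disorders, TRIPOD LAW ⟺ DISCRETE HOLOMORPHICITY ON EVERY SEVEN-MARKED DOMAIN**;
* ★★★ `tripodLaw_iff_holomorphicW_rotates_seven` — SEVEN DOMAINS SUFFICE: the seven rotations (relabellings) of the one marked 8-site rhombus;
* ★★ `holomorphic_const_iff_seven` — an `L`-INDEPENDENT seven-disorder weight (an observable built from the link CLASSES only) is discretely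
  holomorphic on every seven-marked domain iff it is CONSTANT (in the tree for `k = 5`; for every odd `k ≥ 5` modulo necessity in
  `MarkedLoopClassOnly.lean` — here unconditionally at `k = 7`). The fourteen-parameter classification (with SOLVED-SEVEN's basis) is the rider
`MarkedLoopNecessitySevenBasis.lean`.

The converse direction is the lane's statement; Khristoforov–Smirnov prove sufficiency (Lemma 4).

## References
* M. Khristoforov, S. Smirnov, *Percolation and O(1) loop model*, arXiv:2111.15612 (2021), §2 Definition 3 and Lemma 4 with its proof and Fig. 3
  (arXiv v1 p. 4), §3 Remark 6 (p. 5).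
* B. Bollobás, O. Riordan, *Percolation*, Cambridge University Press (2006), Ch. 7 §7.2.2 (pp. 192–193), §7.2.3 p. 197.

## Mathlib / tree
Tree: `MarkedLoopNecessitySeven.lean` (`classDefects_eq_zero_of_holomorphicW_rotates_seven`), `MarkedLoopPicturesSeven.lean` (`tripodLaw_seven_iff`),
`MarkedLoopSevenClasses.lean` (`defA`, `defN`, `defM`, `tau_sq_eq₇`, `tau_im_ne_zero₇`), `MarkedLoopHolomorphicDefect.lean` (`holomorphicW_of_tripodLaw'`), `TriRhombusDomain.lean`
(`rhombus24SevenB`). Mathlib: `linear_combination`, `decide`.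
-/

open Finset

namespace Literature.Probability.Percolation.MarkedLoops

open Literature.Probability.Percolation Literature.Probability.LatticeModels
open Literature.Probability.Percolation.FivePoint (tau)
open TriMarkedDomain

/-- ★★★ **SEVEN DOMAINS SUFFICE**: TRIPOD LAW ⟺ holomorphic on the seven rotations of the marked rhombus `rhombus24SevenB`.
[cite: KhristoforovSmirnov2021, §2 Lemma 4 (arXiv v1 p. 4); BollobasRiordan2006, Ch. 7 §7.2.2 (pp. 192–193), §7.2.3 p. 197] -/
theorem tripodLaw_iff_holomorphicW_rotates_seven (wt : Fin 7 → Finset (Fin 7 × Fin 7) → ℂ) :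
    TripodLaw wt ↔ ∀ m : ℕ, m < 7 → HolomorphicW (TriMarkedDomain.rotate^[m] rhombus24SevenB) wt :=
  ⟨fun h _ _ => holomorphicW_of_tripodLaw' _ h, fun h => (tripodLaw_seven_iff wt).2 (classDefects_eq_zero_of_holomorphicW_rotates_seven wt h)⟩

/-- ★★★★ **SEVEN DISORDERS: TRIPOD LAW ⟺ DISCRETE HOLOMORPHICITY ON EVERY SEVEN-MARKED DOMAIN.** The forward implication is Khristoforov–Smirnov's
Lemma 4 for class weights (HOLO-K, every `k`); the converse is the census certificate of `MarkedLoopNecessitySeven.lean`.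
[cite: KhristoforovSmirnov2021, §2 Lemma 4 (arXiv v1 p. 4)] -/
theorem tripodLaw_iff_forall_holomorphicW_seven (wt : Fin 7 → Finset (Fin 7 × Fin 7) → ℂ) :
    TripodLaw wt ↔ ∀ D : TriMarkedDomain 7, HolomorphicW D wt :=
  ⟨fun h D => holomorphicW_of_tripodLaw' D h, fun h => (tripodLaw_seven_iff wt).2 (classDefects_eq_zero_of_forall_holomorphicW_seven wt h)⟩

/-! ### In Khristoforov–Smirnov's terms: no class-only holomorphic observable at seven disorders except the constant -/

/-- the adjacent- and nested-class defects of an `L`-independent weight coincide: both are `c_a + τ c_{a+1} + τ² c_{a+2}`; the mid-class defect is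
`c_a + τ c_{a+1} + τ² c_{a+4}`. [cite: KhristoforovSmirnov2021, §2 Definition 3 (arXiv v1 p. 4: `H_j`, `F = Σ_j τ^j H_j`)] -/
theorem classDefects_const (c : Fin 7 → ℂ) (a : Fin 7) :
    defA (fun (j : Fin 7) (_ : Finset (Fin 7 × Fin 7)) => c j) a = c a + tau * c (a + 1) + tau ^ 2 * c (a + 2) ∧
      defN (fun (j : Fin 7) (_ : Finset (Fin 7 × Fin 7)) => c j) a = c a + tau * c (a + 1) + tau ^ 2 * c (a + 2) ∧
        defM (fun (j : Fin 7) (_ : Finset (Fin 7 × Fin 7)) => c j) a = c a + tau * c (a + 1) + tau ^ 2 * c (a + 4) :=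
  ⟨rfl, rfl, rfl⟩

/-- the seven-plus-seven cyclic relations `c_a + τ c_{a+1} + τ² c_{a+2} = 0`, `c_a + τ c_{a+1} + τ² c_{a+4} = 0` force `c` to be CONSTANT (and
conversely): subtracting, `c_{a+2} = c_{a+4}`, so `c` has period `2`, hence (7 odd) is constant. [cite: KhristoforovSmirnov2021, §2 Definition 3 and Lemma 4 (arXiv v1 p. 4)] -/
theorem const_relations_seven_iff (c : Fin 7 → ℂ) :
    (∀ a : Fin 7, c a + tau * c (a + 1) + tau ^ 2 * c (a + 2) = 0 ∧ c a + tau * c (a + 1) + tau ^ 2 * c (a + 4) = 0) ↔ ∀ j : Fin 7, c j = c 0 := by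
  have hτ2 : tau ^ 2 ≠ 0 := pow_ne_zero 2 fun h => tau_im_ne_zero₇ (by rw [h, Complex.zero_im])
  constructor
  · intro h
    have step : ∀ a : Fin 7, c (a + 2) = c (a + 4) := by
      intro a
      obtain ⟨h1, h2⟩ := h a
      have : tau ^ 2 * (c (a + 2) - c (a + 4)) = 0 := by linear_combination h1 - h2
      exact sub_eq_zero.1 ((mul_eq_zero.1 this).resolve_left hτ2)
    -- period two around ℤ/7 ⇒ constant (2 generates ℤ/7)
    have h2 : ∀ a : Fin 7, c (a + 2) = c a := fun a => by
      have e := step (a + 5)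
      have e1 : a + 5 + 2 = a := by rw [add_assoc, show (5 : Fin 7) + 2 = 0 from by decide, add_zero]
      have e2 : a + 5 + 4 = a + 2 := by rw [add_assoc, show (5 : Fin 7) + 4 = 2 from by decide]
      rw [e1, e2] at e
      exact e.symm
    have v2 : c 2 = c 0 := by have e := h2 0; rwa [zero_add] at e
    have v4 : c 4 = c 0 := by have e := h2 2; rw [show (2 : Fin 7) + 2 = 4 from by decide] at e; rw [e, v2]
    have v6 : c 6 = c 0 := by have e := h2 4; rw [show (4 : Fin 7) + 2 = 6 from by decide] at e; rw [e, v4]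
    have v1 : c 1 = c 0 := by have e := h2 6; rw [show (6 : Fin 7) + 2 = 1 from by decide] at e; rw [e, v6]
    have v3 : c 3 = c 0 := by have e := h2 1; rw [show (1 : Fin 7) + 2 = 3 from by decide] at e; rw [e, v1]
    have v5 : c 5 = c 0 := by have e := h2 3; rw [show (3 : Fin 7) + 2 = 5 from by decide] at e; rw [e, v3]
    have idx : ∀ j : Fin 7, j = 0 ∨ j = 1 ∨ j = 2 ∨ j = 3 ∨ j = 4 ∨ j = 5 ∨ j = 6 := by decide
    intro j
    rcases idx j with rfl | rfl | rfl | rfl | rfl | rfl | rfl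
    · rfl
    · exact v1
    · exact v2
    · exact v3
    · exact v4
    · exact v5
    · exact v6
  · intro h a
    rw [h a, h (a + 1), h (a + 2), h (a + 4)]
    constructor <;> linear_combination (c 0) * tau_sq_eq₇

/-- ★★ **NO CLASS-ONLY PARAFERMION AT SEVEN DISORDERS**: an `L`-INDEPENDENT seven-disorder class weight `j ↦ c_j` is discretely holomorphic on every
seven-marked domain iff it is CONSTANT. (Khristoforov–Smirnov define `F = Σ_j τ^j H_j` for three disorders only; the seven-class statement is the
lane's — cf. the tree's `holomorphic_const_iff_five` and `MarkedLoopClassOnly.lean`.) [cite: KhristoforovSmirnov2021, §2 Definition 3 and Lemma 4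
(arXiv v1 p. 4); §3 Remark 6 (p. 5)] -/
theorem holomorphic_const_iff_seven (c : Fin 7 → ℂ) :
    (∀ D : TriMarkedDomain 7, HolomorphicW D (fun (j : Fin 7) (_ : Finset (Fin 7 × Fin 7)) => c j)) ↔ ∀ j : Fin 7, c j = c 0 := by
  rw [← tripodLaw_iff_forall_holomorphicW_seven, tripodLaw_seven_iff, ← const_relations_seven_iff]
  refine forall_congr' fun a => ?_
  obtain ⟨e1, e2, e3⟩ := classDefects_const c a
  rw [e1, e2, e3]
  tauto

end Literature.Probability.Percolation.MarkedLoops
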